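import Mathlib.GroupTheory.OrderOfElement
import Mathlib.Algebra.Group.Subgroup.Map
import Mathlib.Algebra.Group.Pi.Lemmas
import Mathlib.Data.Fintype.Pi
import Mathlib.Data.Int.GCD
import HarnessLib

/-!
# Crux `Capture` (stmt-PneNP-2659), line `csp-spine-meet-to-join` — coprime splitting of coset CSPs
# (`coset_unsat_coprime_prod`, regime R-b of the residual dossier)

Over a direct product `G₁ × G₂` of groups of coprime orders every subgroup of `(G₁ × G₂)^I` is the product of
its two projections (power maps), so a coset CSP over `G₁ × G₂` is unsatisfiable iff one of its two projected
CSPs is: the coset gate is the `∨` of a `G₁`-coset gate and a `G₂`-coset gate. This reduces nilpotent groups to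
their Sylow subgroups. Mathlib only. Continuation lead c1, 2026-08-16. [folklore]
-/

namespace Summit.PneNP.PneNP.Cruxes.Capture.CspSpineMeetToJoin

set_option linter.dupNamespace false -- `Summit.PneNP.PneNP.…`: summit = sub-problem (D-0017)

/-- **Coprime splitting of coset CSPs** (registered sub-goal `coset_unsat_coprime_prod`). [folklore] -/
theorem coset_unsat_coprime_prod : ∀ (G₁ G₂ : Type) [Group G₁] [Group G₂] [Fintype G₁] [Fintype G₂],
    (Fintype.card G₁).Coprime (Fintype.card G₂) →
    ∀ (nv m : ℕ) (r : Fin m → ℕ) (scope : (j : Fin m) → Fin (r j) → Fin nv)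
      (H : (j : Fin m) → Subgroup (Fin (r j) → G₁ × G₂)) (c : (j : Fin m) → Fin (r j) → G₁ × G₂)
      (v : Fin m → Bool),
      (¬ ∃ h : Fin nv → G₁ × G₂, ∀ j, v j = true → (c j)⁻¹ * (fun i => h (scope j i)) ∈ H j) ↔
      ((¬ ∃ h : Fin nv → G₁, ∀ j, v j = true →
          (fun i => (c j i).1)⁻¹ * (fun i => h (scope j i)) ∈ (H j).map (MonoidHom.compLeft (MonoidHom.fst G₁ G₂) _)) ∨
       (¬ ∃ h : Fin nv → G₂, ∀ j, v j = true →
          (fun i => (c j i).2)⁻¹ * (fun i => h (scope j i)) ∈ (H j).map (MonoidHom.compLeft (MonoidHom.snd G₁ G₂) _))) := by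
  intro G₁ G₂ _ _ _ _ hcop nv m r scope H c v
  classical
  -- power maps: in a finite group `P` of order coprime to `e`, `k ↦ k ^ e` hits every element as `k = (k^e)^M`
  have hpow : ∀ (P : Type) [Group P] [Fintype P] (e : ℕ), (Fintype.card P).Coprime e →
      ∃ M : ℕ, ∀ k : P, (k ^ e) ^ M = k := by
    intro P _ _ e he
    by_cases h1 : Fintype.card P = 1
    · refine ⟨0, fun k => ?_⟩
      haveI : Subsingleton P := Fintype.card_le_one_iff_subsingleton.1 h1.le
      exact Subsingleton.elim _ _
    · have hlt : 1 < Fintype.card P := lt_of_le_of_ne Fintype.card_pos (Ne.symm h1)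
      obtain ⟨M, -, hM⟩ := Nat.exists_mul_mod_eq_one_of_coprime (k := Fintype.card P) (n := e) he.symm hlt
      refine ⟨M, fun k => ?_⟩
      rw [← pow_mul, ← pow_mod_card (n := e * M), hM, pow_one]
  -- the two components of an element of a subgroup of `(G₁ × G₂)^I` lie in it separately
  have hsplit : ∀ (I : Type) [Fintype I] (K : Subgroup (I → G₁ × G₂)) (k : I → G₁ × G₂), k ∈ K →
      (fun i => ((k i).1, (1 : G₂))) ∈ K ∧ (fun i => ((1 : G₁), (k i).2)) ∈ K := by
    intro I _ K k hk
    have hc1 : (Fintype.card (I → G₁)).Coprime (Fintype.card (I → G₂)) := by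
      rw [Fintype.card_fun, Fintype.card_fun]; exact hcop.pow _ _
    constructor
    · obtain ⟨M, hM⟩ := hpow (I → G₁) (Fintype.card (I → G₂)) hc1
      have : (fun i => ((k i).1, (1 : G₂))) = (k ^ Fintype.card (I → G₂)) ^ M := by
        have h2 : (fun i => (k i).2) ^ Fintype.card (I → G₂) = 1 := pow_card_eq_one
        funext i
        have h1i := congrFun (hM fun i => (k i).1) i
        have h2i := congrFun h2 i
        simp only [Pi.pow_apply, Pi.one_apply] at h1i h2i ⊢
        rw [Prod.pow_def, Prod.pow_def, h2i, one_pow, h1i]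
      rw [this]; exact K.pow_mem (K.pow_mem hk _) _
    · obtain ⟨M, hM⟩ := hpow (I → G₂) (Fintype.card (I → G₁)) hc1.symm
      have : (fun i => ((1 : G₁), (k i).2)) = (k ^ Fintype.card (I → G₁)) ^ M := by
        have h1 : (fun i => (k i).1) ^ Fintype.card (I → G₁) = 1 := pow_card_eq_one
        funext i
        have h2i := congrFun (hM fun i => (k i).2) i
        have h1i := congrFun h1 i
        simp only [Pi.pow_apply, Pi.one_apply] at h1i h2i ⊢
        rw [Prod.pow_def, Prod.pow_def, h1i, one_pow, h2i]
      rw [this]; exact K.pow_mem (K.pow_mem hk _) _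
  -- membership in `K` is membership of the two projections
  have hmem : ∀ (I : Type) [Fintype I] (K : Subgroup (I → G₁ × G₂)) (k : I → G₁ × G₂),
      k ∈ K ↔ (fun i => (k i).1) ∈ K.map (MonoidHom.compLeft (MonoidHom.fst G₁ G₂) I) ∧
        (fun i => (k i).2) ∈ K.map (MonoidHom.compLeft (MonoidHom.snd G₁ G₂) I) := by
    intro I _ K k
    constructor
    · intro hk
      exact ⟨Subgroup.mem_map.2 ⟨k, hk, rfl⟩, Subgroup.mem_map.2 ⟨k, hk, rfl⟩⟩
    · rintro ⟨h1, h2⟩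
      obtain ⟨k₁, hk₁, e₁⟩ := Subgroup.mem_map.1 h1
      obtain ⟨k₂, hk₂, e₂⟩ := Subgroup.mem_map.1 h2
      have ha := (hsplit I K k₁ hk₁).1
      have hb := (hsplit I K k₂ hk₂).2
      have : k = (fun i => ((k₁ i).1, (1 : G₂))) * (fun i => ((1 : G₁), (k₂ i).2)) := by
        funext i
        have e₁i := congrFun e₁ i
        have e₂i := congrFun e₂ i
        simp only [MonoidHom.compLeft_apply, Function.comp_apply, MonoidHom.coe_fst, MonoidHom.coe_snd] at e₁i e₂i
        rw [Pi.mul_apply, Prod.mk_mul_mk, mul_one, one_mul, e₁i, e₂i]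
      rw [this]; exact K.mul_mem ha hb
  -- the CSP splits
  constructor
  · intro hun
    by_contra hboth
    simp only [not_or, not_not] at hboth
    obtain ⟨⟨h₁, hh₁⟩, ⟨h₂, hh₂⟩⟩ := hboth
    refine hun ⟨fun x => (h₁ x, h₂ x), fun j hj => (hmem _ (H j) _).2 ⟨?_, ?_⟩⟩
    · simpa only [Pi.mul_def, Pi.inv_def, Prod.fst_mul, Prod.fst_inv] using hh₁ j hj
    · simpa only [Pi.mul_def, Pi.inv_def, Prod.snd_mul, Prod.snd_inv] using hh₂ j hj
  · rintro (h1 | h2) ⟨h, hh⟩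
    · exact h1 ⟨fun x => (h x).1, fun j hj => by
        simpa only [Pi.mul_def, Pi.inv_def, Prod.fst_mul, Prod.fst_inv] using ((hmem _ (H j) _).1 (hh j hj)).1⟩
    · exact h2 ⟨fun x => (h x).2, fun j hj => by
        simpa only [Pi.mul_def, Pi.inv_def, Prod.snd_mul, Prod.snd_inv] using ((hmem _ (H j) _).1 (hh j hj)).2⟩

end Summit.PneNP.PneNP.Cruxes.Capture.CspSpineMeetToJoin
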